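import Literature.Analysis.FluidPDE.LocalLeraySolutions
import Literature.Analysis.FunctionSpaces.WeakLp
import Literature.Analysis.UnboundedOperators.HeatKernel
import HarnessLib

/-!
# The caloric extension of weak-`L³` data obeys the linear local Leray bounds

Analysis/FluidPDE fact file in the decomposition of
`Literature.Analysis.FluidPDE.bradshawTsai2017_dss_localLeray_existence` (Bradshaw–Tsai, Ann.
Henri Poincaré 18 (2017) [BT1], Thm 1.2; see `ForwardDSSLocalLeray.lean`). The verification of
the local Leray axioms in [BT1] §4 (`bradshawTsai2017_section4`) rests on four properties of the
heat flow `V₀ = e^{tΔ}v₀` of the datum `v₀ ∈ L³_w(ℝ³) ⊂ L²_uloc(ℝ³)`, which [BT1] quote without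
proof:

> "*Locally finite energy and enstrophy:* This follows from inequality (4.1) noting that
> `v₀ ∈ L²_uloc` implies `e^{tΔ}v₀` has uniformly locally finite energy and enstrophy.
> *Convergence to initial data:* … `e^{tΔ}v₀ → v₀` in `L²_{-3/2}(ℝ³)` (see [Kato]), and this space
> embeds in `L²_loc`, we conclude that `e^{tΔ}v₀ → v₀` in `L²_loc(ℝ³)` as `t → 0⁺`. … *Decay at
> spatial infinity:* … the fact that `e^{tΔ}v₀(x)` satisfies the same decay requirements at
> spatial infinity as a local Leray solution (this is easy to see given that `v₀ ∈ L²_uloc(ℝ³))`"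

([BT1] §4, proof of Thm 1.2). This file states them as ONE named fact over a predicate
`IsCaloricLocalLerayField v₀ V` collecting exactly the clauses (2), (3), (7) of the tree's
`IsLocalLeraySolution` (Kang–Miura–Tsai Def. 3.2 = [BT1] Def. 1.1) for a field `V` with datum
`v₀`, together with the regularity that makes them meaningful (continuity on the open slab, a weak
spatial gradient there):

* `IsCaloricLocalLerayField v₀ V`: `V` is continuous on `(0,∞) × ℝ³`; for every `R > 0`,
  `sup_{0<t<R²} sup_{x₀} ∫_{B_R(x₀)} |V(t)|² < ∞` and, for a weak spatial gradient `H` of `V` on the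
  slab, `sup_{x₀} ∫₀^{R²}∫_{B_R(x₀)} |H|² < ∞`; `V(t) → v₀` in `L²(K)` for compact `K` as `t → 0⁺`;
  `∫₀^{R²}∫_{B_R(x₀)} |V|² → 0` as `|x₀| → ∞`.
* `bradshawTsai2017_caloric_localLeray` (**[BT1] §4**, the three quoted claims): for
  `v₀ ∈ L³_w(ℝ³)`, the caloric extension `UnboundedOperators.heatExtension v₀` (the tree's
  `e^{tΔ}v₀ = Γ(t) ⋆ v₀`) is an `IsCaloricLocalLerayField v₀`.
* Proved: non-vacuity (`isCaloricLocalLerayField_zero`).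

## Why the fact is true as stated (and where it is printed with proof)

`L³_w(ℝ³) ⊂ L²_uloc(ℝ³)` ([BT1] §1: "`L³_w(ℝ³)` embeds continuously into the space of uniformly
locally square integrable functions `L²_uloc`"), and moreover the local `L²`-mass of an `L^{3,∞}`
function tends to `0` at infinity (`|f|² 𝟙_{|f|>ε} ∈ L¹` while `|f|² 𝟙_{|f|≤ε} ≤ ε²`), i.e.
`L³_w ⊂ E²`. For `u₀ ∈ L²_uloc` the uniformly local energy and enstrophy bounds of `W_t ⋆ u₀` on
`(0,T) × ℝ³`, `T ≤ 1`, are Lemarié-Rieusset, *The Navier–Stokes problem in the 21st century*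
(2016), proof of Thm 14.1, Step 1, estimate (14.5) (`‖W_{νt} ⋆ u₀‖_{E_ε} ≤ C_ν ‖u₀‖_{L²_uloc}`,
the `E_ε`-norm being `sup_{0<t<T} sup_x ‖u(t)‖_{L²(B(x,1))} + sup_x ‖∇⊗u‖_{L²((0,T)×B(x,1))}`);
general `R` follows by the scaling `x ↦ Rx`, `t ↦ R²t`, which preserves `L²_uloc`. Continuity
(indeed smoothness) of `Γ(t) ⋆ u₀` on `t > 0` is differentiation under the absolutely convergent
Gauss–Weierstrass integral (Evans, *PDE*, §2.3.1). Convergence `W_t ⋆ u₀ → u₀` in `L²(K)`: split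
`u₀ = u₀𝟙_{B_{3R}} + u₀𝟙_{B_{3R}ᶜ}`; the first piece is in `L²` (strong continuity of the heat
semigroup), the second has caloric extension `O(t)` uniformly on `B_R` (loc. cit., Step 1:
"`|W_{νt} ⋆ u_{2,x}(y)| ≤ C ∫_{|x−z|>3} νt |x−z|⁻⁵ |u₀(z)| dz`"). Decay at infinity for `u₀ ∈ E²`:
the same splitting (cf. loc. cit. Thm 14.3). None of this is in the tree yet; the fact is meant
to be discharged.

## Mathlib / tree search

Mathlib (this pin): Gaussian integrals and the Fourier transform of Gaussians, but no heat
semigroup on uniformly local spaces, no `L²_uloc`/`E²`. Tree (`lean search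
'uloc|UniformlyLocal|MemWeakLp.*heat'`: none): the caloric extension
`UnboundedOperators.heatExtension` with its `L^p` theory as named facts/discharges
(`UnboundedOperators/HeatKernel`, `HeatFlowCalculus`: `continuousOn_uncurry_heatExtension_of_memLp`,
`continuousOn_uncurry_fderiv_heatExtension_of_memLp`, `tendsto_heatExtension_nhdsGT_zero_of_continuousAt`;
`HeatKernelHeatEquation`: `contDiffOn_uncurry_heatExtension` for compactly supported locally
integrable data) — all for `MemLp` or compactly supported data, whereas `L³_w ⊄ L^p`; a discharge
of the fact below will split `v₀ = v₀𝟙_{B_{3R}(x₀)} + v₀𝟙_{B_{3R}(x₀)ᶜ}` and combine that `L²`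
theory with pointwise Gaussian tail bounds, as in Lemarié-Rieusset's proof. Reused here:
`IsLocalLeraySolution`'s clause shapes (`LocalLeraySolutions`), `HasWeakSpatialGradientOn`,
`frobeniusNormSq`, `slab` (`SuitableWeak`), `MemWeakLp` (`FunctionSpaces/WeakLp`).

## Design notes

* Hypothesis `MemWeakLp v₀ 3 volume` only (the setting of [BT1] Thm 1.2; discrete
  self-similarity and divergence-freeness play no role in these linear estimates).
* The energy bound is stated for every `t ∈ (0, R²)` (the caloric extension is continuous), the
  form consumed by `IsLocalLeraySolution.uniformLocalEnergy` (a.e. in `t`) and by the attainment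
  of the datum.
* `UnboundedOperators.heatExtension v₀ : ℝ → ℝ³ → ℝ³` is a time-first space–time field; its values
  for `t ≤ 0` are junk and no clause sees them.

## References

* Z. Bradshaw, T.-P. Tsai, Ann. Henri Poincaré 18 (2017) 1095–1119 = arXiv:1510.07504, §1
  (`L³_w ⊂ L²_uloc`), §4 (proof of Thm 1.2) [BradshawTsai2017AHP].
* P. G. Lemarié-Rieusset, *The Navier–Stokes problem in the 21st century*, CRC Press 2016,
  Lemma 14.1, Thm 14.1 (proof, Step 1, (14.5)), Prop. 14.1, Def. 14.1, Thm 14.3, Def. 14.2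
  [LemarieRieusset2016].
* K. Kang, H. Miura, T.-P. Tsai, IMRN 2021, Def. 3.2 [KangMiuraTsai2020].
* L. C. Evans, *Partial differential equations*, §2.3.1 [Evans2010].
-/

noncomputable section

open MeasureTheory Set Function Filter Topology TopologicalSpace Metric
open scoped NNReal ENNReal

namespace Literature.Analysis.FluidPDE

/-- Local notation for physical space `ℝ³ = EuclideanSpace ℝ (Fin 3)`. -/
local notation "ℝ³" => EuclideanSpace ℝ (Fin 3)

/-- **Linear local Leray bounds** for a space–time field `V : ℝ → ℝ³ → ℝ³` (time first) with
datum `v₀`: the clauses (2), (3), (7) of Kang–Miura–Tsai's Def. 3.2 (= [BT1] Def. 1.1,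
`IsLocalLeraySolution`) — uniformly local energy `sup_{0<t<R²} sup_{x₀} ∫_{B_R(x₀)} |V(t)|² < ∞`
and enstrophy `sup_{x₀} ∫₀^{R²}∫_{B_R(x₀)} |∇V|² < ∞` for every `R > 0` (`∇V` a weak spatial
gradient on the open slab `(0,∞) × ℝ³`), attainment of the datum `V(t) → v₀` in `L²(K)` for
compact `K`, and decay `∫₀^{R²}∫_{B_R(x₀)} |V|² → 0` as `|x₀| → ∞` — together with continuity of
`V` on the open slab. This is what [BT1] §4 asserts of `V = e^{tΔ}v₀` ("`e^{tΔ}v₀` has uniformly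
locally finite energy and enstrophy … `e^{tΔ}v₀ → v₀` in `L²_loc` … satisfies the same decay
requirements at spatial infinity as a local Leray solution"). [cite: BradshawTsai2017AHP, §4 (proof of Thm 1.2) with Def. 1.1] -/
structure IsCaloricLocalLerayField (v₀ : ℝ³ → ℝ³) (V : ℝ → ℝ³ → ℝ³) : Prop where
  /-- `V` is continuous on the open slab `(0, ∞) × ℝ³`. -/
  continuousOn : ContinuousOn (uncurry V) (Ioi (0 : ℝ) ×ˢ (univ : Set ℝ³))
  /-- Uniformly local energy: `sup_{0<t<R²} sup_{x₀} ∫_{B_R(x₀)} |V(x,t)|² dx < ∞`, `R > 0`. -/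
  uniformLocalEnergy : ∀ R : ℝ, 0 < R → ∃ C : ℝ≥0,
    ∀ t ∈ Ioo (0 : ℝ) (R ^ 2), ∀ x₀ : ℝ³, ∫⁻ x in ball x₀ R, ‖V t x‖ₑ ^ 2 ≤ C
  /-- Uniformly local enstrophy: a weak spatial gradient `H = ∇V` on the slab with
  `sup_{x₀} ∫₀^{R²} ∫_{B_R(x₀)} |∇V|² dx dt < ∞` for every `R > 0`. -/
  uniformLocalGradient : ∃ H : ℝ → ℝ³ → ℝ³ →L[ℝ] ℝ³,
    HasWeakSpatialGradientOn (slab ℝ³ (Ioi 0) isOpen_Ioi) V H ∧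
    ∀ R : ℝ, 0 < R → ∃ C : ℝ≥0, ∀ x₀ : ℝ³,
      ∫⁻ z in Ioo 0 (R ^ 2) ×ˢ ball x₀ R, ENNReal.ofReal (frobeniusNormSq (H z.1 z.2)) ≤ C
  /-- The datum is attained in `L²_loc`: `∫_K |V(t) − v₀|² → 0` as `t → 0⁺`, `K` compact. -/
  initial : ∀ K : Set ℝ³, IsCompact K →
    Tendsto (fun t => ∫⁻ x in K, ‖V t x - v₀ x‖ₑ ^ 2) (𝓝[>] 0) (𝓝 0)
  /-- Decay at spatial infinity: `∫₀^{R²} ∫_{B_R(x₀)} |V|² → 0` as `|x₀| → ∞`, `R > 0`. -/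
  decay : ∀ R : ℝ, 0 < R →
    Tendsto (fun x₀ : ℝ³ => ∫⁻ z in Ioo 0 (R ^ 2) ×ˢ ball x₀ R, ‖V z.1 z.2‖ₑ ^ 2)
      (cocompact ℝ³) (𝓝 0)

/-- **Non-vacuity.** The zero field has the linear local Leray bounds with datum `0`. [folklore] -/
theorem isCaloricLocalLerayField_zero :
    IsCaloricLocalLerayField (0 : ℝ³ → ℝ³) (0 : ℝ → ℝ³ → ℝ³) where
  continuousOn := continuousOn_const
  uniformLocalEnergy R _ := ⟨0, fun t _ x₀ => by simp⟩
  uniformLocalGradient := ⟨0, hasWeakSpatialGradientOn_zero _, fun R _ => ⟨0, fun x₀ => by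
    simp [frobeniusNormSq_zero]⟩⟩
  initial K _ := by simp
  decay R _ := by simp

/-- **[BT1] §4: the caloric extension of a weak-`L³` datum obeys the linear local Leray bounds.**
For `v₀ ∈ L³_w(ℝ³)` (`⊂ L²_uloc`, [BT1] §1), the heat flow `V₀(t) = e^{tΔ}v₀ = Γ(t) ⋆ v₀`
(`UnboundedOperators.heatExtension v₀`) is continuous on `(0,∞) × ℝ³`, "has uniformly locally
finite energy and enstrophy" (Lemarié-Rieusset 2016, proof of Thm 14.1, Step 1, (14.5):
`‖W_{νt} ⋆ u₀‖_{E_ε} ≤ C_ν ‖u₀‖_{L²_uloc}`, rescaled to radius `R`), "`e^{tΔ}v₀ → v₀` in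
`L²_loc(ℝ³)` as `t → 0⁺`", and "satisfies the same decay requirements at spatial infinity as a
local Leray solution" (`L³_w ⊂ E²`). See the module docstring for the proof sketch; the statement
is the conjunction `IsCaloricLocalLerayField v₀ (e^{·Δ}v₀)`. [cite: BradshawTsai2017AHP, §4 (proof of Thm 1.2)] -/
def bradshawTsai2017_caloric_localLeray : Prop :=
  ∀ {v₀ : ℝ³ → ℝ³}, FunctionSpaces.MemWeakLp v₀ 3 volume →
    IsCaloricLocalLerayField v₀ (UnboundedOperators.heatExtension v₀)

end Literature.Analysis.FluidPDE

end
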